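import Literature.AlgebraicGeometry.HodgeTheory.LefschetzDecompositionSingular
import HarnessLib

/-!
# The polarisation form of a Lefschetz decomposition (Voisin I, §6.3.2 and §7.1.2)

Layer `Literature/AlgebraicGeometry/HodgeTheory`, linear algebra over an arbitrary commutative
coefficient ring `R` on the singular cohomology `H•(Y; R)` of a space `Y`, for a class
`κ ∈ H²(Y; R)` with the hard Lefschetz property in dimension `n` (`HasHardLefschetzProperty κ n`) and
`Hᵐ(Y; R) = 0` for `m > 2n` — the sequel of `LefschetzDecompositionSingular` ("linear algebra used by
the polarisation file"). Brick B6 (generic part) of the programme proving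
`smoothProjective_hodgeStructure_isPolarizable` (Voisin I §7.1.2: the Hodge structure on `Hᵏ(X, ℚ)`
of a smooth projective variety is polarised).

Voisin I, §6.3.2 / §7.1.2: with the Lefschetz decomposition `x = ∑ᵣ Lʳ xᵣ`, `xᵣ ∈ H^{k-2r}_prim`
(Cor. 6.26), the form polarising `Hᵏ(X, ℚ)` is the "twisted" intersection form
`Q(x, y) = ∑ᵣ (-1)^{a(a-1)/2} ∫ L^{n-a} xᵣ ∪ yᵣ` (`a = k - 2r`), the sign alternating with the
Lefschetz component (Thm. 6.32: "the form `(-1)^{k(k-1)/2} i^{p-q-k} H_k` is positive definite on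
`H^{p,q}_prim`"; Rem. 6.33: the signs differ on the various Lefschetz components, so the
decomposition is needed). This file defines that form for an abstract "trace" `τ : H^{2n}(Y; R) → R`
and proves its coefficient-free properties:

* `primitivePart κ n hL hvan p` — the **primitive part** `ξ_p : Hⁱ → Hᵃ` of index `p = (a, t)`,
  `a + 2t = i`: the unique primitive `ξ` with `Lᵗ ξ = π_p x` (`π_p` the Lefschetz projection of
  `LefschetzDecompositionSingular`; `Lᵗ` is injective on `Hᵃ` for `a + t ≤ n`, and the summand is
  `0` otherwise), with `∑_p Lᵗ ξ_p x = x` (`sum_lefschetzPowTo_primitivePart`), uniqueness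
  (`primitivePart_eq_of_sum_eq`), compatibility with additive maps commuting with `L`
  (`map_primitivePart_of_commute`) and with change of coefficients (`ringChange_primitivePart_of_eq`).
* `hodgeRiemannPairing κ n τ a` — `(ξ, ξ') ↦ (-1)^{a(a-1)/2} τ(L^{n-a} ξ ∪ ξ')` on `Hᵃ`, `a ≤ n`
  (`0` for `a > n`), `(-1)ᵃ`-symmetric (`hodgeRiemannPairing_flip`).
* `polarizationForm κ n hL hvan τ i` — **`Q(x, y) = ∑_p (-1)^{a(a-1)/2} τ(L^{n-a} ξ_p x ∪ ξ_p y)`**,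
  an `R`-bilinear form on `Hⁱ(Y; R)`, `(-1)ⁱ`-symmetric (`polarizationForm_flip`), compatible with
  change of coefficients (`map_polarizationForm_of_eq`: for `ℚ ⊆ ℂ` the complexified form is the
  same formula on `H•(Y; ℂ)`).

The Hodge-theoretic properties (orthogonality of `Fᵖ` and `F^{k+1-p}`, positivity on `H^{p,q}`)
are proved for `Y = X(ℂ)` in the sequel. No named facts are introduced (D-0026).

## References

* [VoisinHodgeI2002] C. Voisin, Hodge Theory and Complex Algebraic Geometry I (2002), §6.2.3
  Cor. 6.26, §6.3.2 Thm. 6.32 and Rem. 6.33, §7.1.2.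
* [HatcherAT2002] A. Hatcher, Algebraic Topology (2002), §3.2 p. 211, Thm. 3.11, §3.1 p. 198.
-/

noncomputable section

universe u v

namespace Literature.AlgebraicGeometry.HodgeTheory

section HodgeTheory

open Literature.AlgebraicTopology.SingularHomology Literature.Geometry.Kaehler

variable {Y : Type u} [TopologicalSpace Y] {R : Type v} [CommRing R]
variable (κ : singularCohomology R R Y 2) (n : ℕ) (hL : HasHardLefschetzProperty κ n)
  (hvan : ∀ m, 2 * n < m → Subsingleton (singularCohomology R R Y m))

/-! ### The primitive part of a class along a Lefschetz index -/

/-- The **primitive part of index `p = (a, t)`**, `a + 2t = i`, of a class `x ∈ Hⁱ(Y; R)`: the unique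
primitive `ξ_p x ∈ Hᵃ_prim` with `Lᵗ (ξ_p x) = π_p x`, the `p`-th component of `x` in the Lefschetz
decomposition `Hⁱ = ⨁_{a+2t=i} Lᵗ Hᵃ_prim` (Voisin I Cor. 6.26: "every `x ∈ Hᵏ` can be written
uniquely `x = ∑ᵣ Lʳ xᵣ`, `xᵣ` primitive"); `Lᵗ : Hᵃ → Hⁱ` is injective for `a + t ≤ n`
(`injective_lefschetzPowTo_of_le`), and for `a + t > n` the summand vanishes and `ξ_p := 0`.
[cite: VoisinHodgeI2002, §6.2.3 Cor. 6.26] -/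
def primitivePart {i : ℕ} (p : {p : ℕ × ℕ // p.1 + 2 * p.2 = i}) :
    singularCohomology R R Y i →ₗ[R] singularCohomology R R Y p.1.1 :=
  if hp : p.1.1 + p.1.2 ≤ n then
    (LinearEquiv.ofInjective (lefschetzPowTo κ p.1.2 p.1.1 i p.2)
        (injective_lefschetzPowTo_of_le κ n hL hp p.2)).symm.toLinearMap ∘ₗ
      LinearMap.codRestrict (LinearMap.range (lefschetzPowTo κ p.1.2 p.1.1 i p.2))
        (internalProj (isInternal_lefschetzSummand κ n hL hvan i) p)
        (fun x ↦ by
          obtain ⟨x', -, hx'⟩ := (mem_lefschetzSummand_iff p _).1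
            (internalProj_mem (isInternal_lefschetzSummand κ n hL hvan i) p x)
          exact ⟨x', hx'⟩)
  else 0

variable {κ n}

/-- **`Lᵗ (ξ_p x) = π_p x`** for `p = (a, t)` with `a + t ≤ n`. [cite: VoisinHodgeI2002, §6.2.3 Cor. 6.26] -/
theorem lefschetzPowTo_primitivePart {i : ℕ} (p : {p : ℕ × ℕ // p.1 + 2 * p.2 = i})
    (hp : p.1.1 + p.1.2 ≤ n) (x : singularCohomology R R Y i) :
    lefschetzPowTo κ p.1.2 p.1.1 i p.2 (primitivePart κ n hL hvan p x) =
      internalProj (isInternal_lefschetzSummand κ n hL hvan i) p x := by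
  unfold primitivePart
  rw [dif_pos hp, LinearMap.comp_apply, LinearEquiv.coe_toLinearMap,
    LinearEquiv.ofInjective_symm_apply, LinearMap.codRestrict_apply]

/-- For `a + t > n` the primitive part of index `(a, t)` is `0` (the summand `Lᵗ Hᵃ_prim` vanishes).
[cite: VoisinHodgeI2002, §6.2.3 Cor. 6.26] -/
theorem primitivePart_of_lt {i : ℕ} (p : {p : ℕ × ℕ // p.1 + 2 * p.2 = i}) (hp : n < p.1.1 + p.1.2) :
    primitivePart κ n hL hvan p = 0 := by
  unfold primitivePart
  rw [dif_neg (not_le.2 hp)]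

/-- For `a + t > n` the Lefschetz projection of index `(a, t)` vanishes. [cite: VoisinHodgeI2002, §6.2.3 Cor. 6.26] -/
theorem internalProj_lefschetzSummand_of_lt {i : ℕ} (p : {p : ℕ × ℕ // p.1 + 2 * p.2 = i})
    (hp : n < p.1.1 + p.1.2) (x : singularCohomology R R Y i) :
    internalProj (isInternal_lefschetzSummand κ n hL hvan i) p x = 0 := by
  have h := internalProj_mem (isInternal_lefschetzSummand κ n hL hvan i) p x
  rwa [lefschetzSummand_eq_bot_of_lt κ n p hp, Submodule.mem_bot] at h

/-- `Lᵗ (ξ_p x) = π_p x` for every index (both sides vanish when `a + t > n`).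
[cite: VoisinHodgeI2002, §6.2.3 Cor. 6.26] -/
theorem lefschetzPowTo_primitivePart' {i : ℕ} (p : {p : ℕ × ℕ // p.1 + 2 * p.2 = i})
    (x : singularCohomology R R Y i) :
    lefschetzPowTo κ p.1.2 p.1.1 i p.2 (primitivePart κ n hL hvan p x) =
      internalProj (isInternal_lefschetzSummand κ n hL hvan i) p x := by
  rcases le_or_gt (p.1.1 + p.1.2) n with hp | hp
  · exact lefschetzPowTo_primitivePart hL hvan p hp x
  · rw [primitivePart_of_lt hL hvan p hp, internalProj_lefschetzSummand_of_lt hL hvan p hp x,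
      LinearMap.zero_apply, LinearMap.map_zero]

/-- **The primitive part is primitive**: `ξ_p x ∈ Hᵃ_prim`. [cite: VoisinHodgeI2002, §6.2.3 Cor. 6.26] -/
theorem primitivePart_mem {i : ℕ} (p : {p : ℕ × ℕ // p.1 + 2 * p.2 = i})
    (x : singularCohomology R R Y i) :
    primitivePart κ n hL hvan p x ∈ primitiveClasses κ n p.1.1 := by
  rcases le_or_gt (p.1.1 + p.1.2) n with hp | hp
  · obtain ⟨x', hx', hx'eq⟩ := (mem_lefschetzSummand_iff p _).1
      (internalProj_mem (isInternal_lefschetzSummand κ n hL hvan i) p x)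
    have heq : primitivePart κ n hL hvan p x = x' :=
      injective_lefschetzPowTo_of_le κ n hL hp p.2
        ((lefschetzPowTo_primitivePart hL hvan p hp x).trans hx'eq.symm)
    rw [heq]
    exact hx'
  · rw [primitivePart_of_lt hL hvan p hp, LinearMap.zero_apply]
    exact Submodule.zero_mem _

/-- **The Lefschetz decomposition**: `∑_{a+2t=i} Lᵗ (ξ_{(a,t)} x) = x` (Voisin I Cor. 6.26).
[cite: VoisinHodgeI2002, §6.2.3 Cor. 6.26] -/
theorem sum_lefschetzPowTo_primitivePart {i : ℕ} (x : singularCohomology R R Y i) :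
    ∑ p : {p : ℕ × ℕ // p.1 + 2 * p.2 = i},
      lefschetzPowTo κ p.1.2 p.1.1 i p.2 (primitivePart κ n hL hvan p x) = x := by
  simp_rw [lefschetzPowTo_primitivePart' hL hvan]
  exact sum_internalProj _ x

/-- **Uniqueness of the Lefschetz decomposition**: if `x = ∑_{a+2t=i} Lᵗ y_{(a,t)}` with primitive
`y_{(a,t)} ∈ Hᵃ_prim`, vanishing for `a + t > n`, then `y_p = ξ_p x` for every index `p`.
[cite: VoisinHodgeI2002, §6.2.3 Cor. 6.26] -/
theorem primitivePart_eq_of_sum_eq {i : ℕ}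
    {y : (p : {p : ℕ × ℕ // p.1 + 2 * p.2 = i}) → singularCohomology R R Y p.1.1}
    (hy : ∀ p, y p ∈ primitiveClasses κ n p.1.1) (hy' : ∀ p, n < p.1.1 + p.1.2 → y p = 0)
    {x : singularCohomology R R Y i}
    (hsum : ∑ p : {p : ℕ × ℕ // p.1 + 2 * p.2 = i}, lefschetzPowTo κ p.1.2 p.1.1 i p.2 (y p) = x)
    (p : {p : ℕ × ℕ // p.1 + 2 * p.2 = i}) : primitivePart κ n hL hvan p x = y p := by
  have hπ : internalProj (isInternal_lefschetzSummand κ n hL hvan i) p x =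
      lefschetzPowTo κ p.1.2 p.1.1 i p.2 (y p) :=
    internalProj_eq_of_sum_eq _ (fun q ↦ lefschetzPowTo_mem_lefschetzSummand q.2 (hy q)) hsum p
  rcases le_or_gt (p.1.1 + p.1.2) n with hp | hp
  · exact injective_lefschetzPowTo_of_le κ n hL hp p.2
      ((lefschetzPowTo_primitivePart hL hvan p hp x).trans hπ)
  · rw [primitivePart_of_lt hL hvan p hp, hy' p hp, LinearMap.zero_apply]

/-- On a Lefschetz summand `Lᵗ Hᵃ_prim` (`a + t ≤ n`) the primitive part of the same index inverts
`Lᵗ`: `ξ_p (Lᵗ x') = x'` for `x'` primitive. [cite: VoisinHodgeI2002, §6.2.3 Cor. 6.26] -/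
theorem primitivePart_lefschetzPowTo_of_mem {i : ℕ} (p : {p : ℕ × ℕ // p.1 + 2 * p.2 = i})
    (hp : p.1.1 + p.1.2 ≤ n) {x' : singularCohomology R R Y p.1.1}
    (hx' : x' ∈ primitiveClasses κ n p.1.1) :
    primitivePart κ n hL hvan p (lefschetzPowTo κ p.1.2 p.1.1 i p.2 x') = x' :=
  injective_lefschetzPowTo_of_le κ n hL hp p.2 (by
    rw [lefschetzPowTo_primitivePart hL hvan p hp,
      internalProj_apply_of_mem _ (lefschetzPowTo_mem_lefschetzSummand p.2 hx')])

/-- The primitive parts of OTHER indices of a class in `Lᵗ Hᵃ_prim` vanish. [cite: VoisinHodgeI2002, §6.2.3 Cor. 6.26] -/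
theorem primitivePart_eq_zero_of_mem_ne {i : ℕ} {p q : {p : ℕ × ℕ // p.1 + 2 * p.2 = i}}
    (hpq : p ≠ q) {x : singularCohomology R R Y i} (hx : x ∈ lefschetzSummand κ n i p) :
    primitivePart κ n hL hvan q x = 0 := by
  rcases le_or_gt (q.1.1 + q.1.2) n with hq | hq
  · apply injective_lefschetzPowTo_of_le κ n hL hq q.2
    rw [lefschetzPowTo_primitivePart hL hvan q hq, internalProj_apply_of_mem_ne _ hpq hx,
      LinearMap.map_zero]
  · rw [primitivePart_of_lt hL hvan q hq, LinearMap.zero_apply]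

/-- **Additive maps commuting with `L` commute with the primitive parts** (they commute with the
Lefschetz projections, `map_internalProj_lefschetzSummand_of_commute`, and with `Lᵗ`, injective).
[cite: VoisinHodgeI2002, §6.2.3 Cor. 6.26] -/
theorem map_primitivePart_of_commute
    (T : ∀ a, singularCohomology R R Y a →+ singularCohomology R R Y a)
    (hT : ∀ (k l : ℕ) (h : 2 + k = l) (x : singularCohomology R R Y k),
      T l (lefschetzOperator κ h x) = lefschetzOperator κ h (T k x))
    {i : ℕ} (p : {p : ℕ × ℕ // p.1 + 2 * p.2 = i}) (x : singularCohomology R R Y i) :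
    T p.1.1 (primitivePart κ n hL hvan p x) = primitivePart κ n hL hvan p (T i x) := by
  rcases le_or_gt (p.1.1 + p.1.2) n with hp | hp
  · apply injective_lefschetzPowTo_of_le κ n hL hp p.2
    rw [← map_lefschetzPowTo_of_commute T hT, lefschetzPowTo_primitivePart hL hvan p hp,
      lefschetzPowTo_primitivePart hL hvan p hp, map_internalProj_lefschetzSummand_of_commute hL hvan T hT]
  · rw [primitivePart_of_lt hL hvan p hp, LinearMap.zero_apply, LinearMap.zero_apply, map_zero]

/-- **Change of coefficients commutes with the primitive parts** (for `κ' = φ_* κ`, both with the hard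
Lefschetz property): `φ_* (ξ_p x) = ξ'_p (φ_* x)` — e.g. for `ℚ ⊆ ℂ`, the primitive parts of a rational
class are rational. [cite: VoisinHodgeI2002, §6.2.3 Cor. 6.26 and §7.1.2] -/
theorem ringChange_primitivePart_of_eq {S : Type v} [CommRing S] (φ : R →+* S)
    {κ' : singularCohomology S S Y 2} (e : singularCohomology.ringChange φ Y 2 κ = κ')
    (hL' : HasHardLefschetzProperty κ' n)
    (hvan' : ∀ m, 2 * n < m → Subsingleton (singularCohomology S S Y m))
    {i : ℕ} (p : {p : ℕ × ℕ // p.1 + 2 * p.2 = i}) (x : singularCohomology R R Y i) :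
    singularCohomology.ringChange φ Y p.1.1 (primitivePart κ n hL hvan p x) =
      primitivePart κ' n hL' hvan' p (singularCohomology.ringChange φ Y i x) := by
  rcases le_or_gt (p.1.1 + p.1.2) n with hp | hp
  · apply injective_lefschetzPowTo_of_le κ' n hL' hp p.2
    rw [← ringChange_lefschetzPowTo_of_eq φ e, lefschetzPowTo_primitivePart hL hvan p hp,
      lefschetzPowTo_primitivePart hL' hvan' p hp,
      ringChange_internalProj_lefschetzSummand_of_eq φ hL hvan e hL' hvan']
  · rw [primitivePart_of_lt hL hvan p hp, primitivePart_of_lt hL' hvan' p hp, LinearMap.zero_apply,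
      LinearMap.zero_apply, map_zero]

/-! ### The Hodge–Riemann pairing on `Hᵃ`, `a ≤ n` -/

variable (κ n) in
/-- The **Hodge–Riemann pairing** `(ξ, ξ') ↦ (-1)^{a(a-1)/2} τ(L^{n-a} ξ ∪ ξ')` on `Hᵃ(Y; R)` for
`a ≤ n` and a "trace" `τ : H^{2n}(Y; R) → R` (Voisin I §6.3.2: up to the sign, the intersection form
`∫ L^{n-k} α ∪ β`; the sign `(-1)^{k(k-1)/2}` is that of Thm. 6.32); set to `0` for `a > n`, where
there are no primitive classes. [cite: VoisinHodgeI2002, §6.3.2 (6.13) and Thm. 6.32] -/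
def hodgeRiemannPairing (τ : singularCohomology R R Y (2 * n) →ₗ[R] R) (a : ℕ) :
    singularCohomology R R Y a →ₗ[R] singularCohomology R R Y a →ₗ[R] R :=
  if ha : a ≤ n then
    ((-1 : R) ^ (a * (a - 1) / 2)) •
      ((cupProduct (show (2 * n - a) + a = 2 * n by omega) ∘ₗ
        lefschetzPowTo κ (n - a) a (2 * n - a) (by omega)).compr₂ τ)
  else 0

/-- Unfolding of the Hodge–Riemann pairing for `a ≤ n`, with the exponent and degrees supplied
explicitly (`a + s = n`, `a + 2s = m`). [cite: VoisinHodgeI2002, §6.3.2] -/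
theorem hodgeRiemannPairing_apply (τ : singularCohomology R R Y (2 * n) →ₗ[R] R) {a s m : ℕ}
    (has : a + s = n) (hm : a + 2 * s = m) (h : m + a = 2 * n)
    (ξ ξ' : singularCohomology R R Y a) :
    hodgeRiemannPairing κ n τ a ξ ξ' =
      (-1 : R) ^ (a * (a - 1) / 2) * τ (cupProduct h (lefschetzPowTo κ s a m hm ξ) ξ') := by
  obtain rfl : s = n - a := by omega
  obtain rfl : m = 2 * n - a := by omega
  unfold hodgeRiemannPairing
  rw [dif_pos (by omega)]
  rfl

/-- For `a > n` the pairing is `0`. [folklore] -/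
theorem hodgeRiemannPairing_of_lt (τ : singularCohomology R R Y (2 * n) →ₗ[R] R) {a : ℕ}
    (ha : n < a) : hodgeRiemannPairing κ n τ a = 0 := by
  unfold hodgeRiemannPairing
  rw [dif_neg (not_le.2 ha)]

/-- **`(-1)ᵃ`-symmetry of the Hodge–Riemann pairing**: `B(ξ', ξ) = (-1)ᵃ B(ξ, ξ')`
(`L^{n-a} ξ' ∪ ξ = L^{n-a}(ξ' ∪ ξ)` by associativity, `ξ' ∪ ξ = (-1)^{a·a} ξ ∪ ξ'` by graded
commutativity, Hatcher Thm. 3.11). [cite: HatcherAT2002, §3.2 p. 211 and Thm. 3.11] -/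
theorem hodgeRiemannPairing_flip (τ : singularCohomology R R Y (2 * n) →ₗ[R] R) (a : ℕ)
    (ξ ξ' : singularCohomology R R Y a) :
    hodgeRiemannPairing κ n τ a ξ' ξ = (-1 : R) ^ a * hodgeRiemannPairing κ n τ a ξ ξ' := by
  rcases le_or_gt a n with ha | ha
  · obtain ⟨s, hs⟩ : ∃ s, a + s = n := ⟨n - a, by omega⟩
    have hm : a + 2 * s = 2 * n - a := by omega
    have h : (2 * n - a) + a = 2 * n := by omega
    rw [hodgeRiemannPairing_apply τ hs hm h, hodgeRiemannPairing_apply τ hs hm h,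
      cupProduct_lefschetzPowTo_left κ s hm h rfl (by omega : (a + a) + 2 * s = 2 * n) ξ' ξ,
      cupProduct_lefschetzPowTo_left κ s hm h rfl (by omega : (a + a) + 2 * s = 2 * n) ξ ξ',
      cupProduct_gradedComm_holds R Y rfl rfl ξ' ξ, LinearMap.map_smul, LinearMap.map_smul,
      smul_eq_mul]
    have hsign : ((-1 : R) ^ (a * a)) = (-1) ^ a := by
      rcases Nat.even_or_odd a with h2 | h2
      · rw [h2.neg_one_pow, (h2.mul_right a).neg_one_pow]
      · rw [h2.neg_one_pow, (h2.mul h2).neg_one_pow]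
    rw [hsign]
    ring
  · simp only [hodgeRiemannPairing_of_lt τ ha, LinearMap.zero_apply, mul_zero]

/-! ### The polarisation form -/

variable (κ n) in
/-- **The polarisation form of the Lefschetz decomposition** on `Hⁱ(Y; R)`:
`Q(x, y) = ∑_{a+2t=i} (-1)^{a(a-1)/2} τ(L^{n-a} ξ_{(a,t)} x ∪ ξ_{(a,t)} y)`, the sum over the
Lefschetz components of the Hodge–Riemann pairings of the primitive parts (Voisin I §6.3.2 with
§7.1.2; Rem. 6.33: the sign changes with the component). [cite: VoisinHodgeI2002, §6.3.2 Thm. 6.32, Rem. 6.33 and §7.1.2] -/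
def polarizationForm (τ : singularCohomology R R Y (2 * n) →ₗ[R] R) (i : ℕ) :
    LinearMap.BilinForm R (singularCohomology R R Y i) :=
  ∑ p : {p : ℕ × ℕ // p.1 + 2 * p.2 = i},
    (hodgeRiemannPairing κ n τ p.1.1).compl₁₂ (primitivePart κ n hL hvan p) (primitivePart κ n hL hvan p)

/-- Unfolding of the polarisation form. [cite: VoisinHodgeI2002, §6.3.2 and §7.1.2] -/
theorem polarizationForm_apply (τ : singularCohomology R R Y (2 * n) →ₗ[R] R) {i : ℕ}
    (x y : singularCohomology R R Y i) :
    polarizationForm κ n hL hvan τ i x y =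
      ∑ p : {p : ℕ × ℕ // p.1 + 2 * p.2 = i},
        hodgeRiemannPairing κ n τ p.1.1 (primitivePart κ n hL hvan p x) (primitivePart κ n hL hvan p y) := by
  unfold polarizationForm
  rw [LinearMap.sum_apply, LinearMap.sum_apply]
  rfl

/-- **`(-1)ⁱ`-symmetry of the polarisation form**: `Q(y, x) = (-1)ⁱ Q(x, y)` on `Hⁱ(Y; R)`
(each Hodge–Riemann pairing on `Hᵃ`, `a + 2t = i`, is `(-1)ᵃ = (-1)ⁱ`-symmetric).
[cite: VoisinHodgeI2002, §7.1.2] [cite: HatcherAT2002, Thm. 3.11] -/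
theorem polarizationForm_flip (τ : singularCohomology R R Y (2 * n) →ₗ[R] R) {i : ℕ}
    (x y : singularCohomology R R Y i) :
    polarizationForm κ n hL hvan τ i y x = (-1 : R) ^ i * polarizationForm κ n hL hvan τ i x y := by
  rw [polarizationForm_apply, polarizationForm_apply, Finset.mul_sum]
  refine Finset.sum_congr rfl fun p _ ↦ ?_
  obtain ⟨⟨a, t⟩, hp⟩ := p
  rw [hodgeRiemannPairing_flip]
  have hsign : ((-1 : R) ^ a) = (-1) ^ i := by
    rw [← hp, pow_add, pow_mul, neg_one_sq, one_pow, mul_one]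
  rw [hsign]

/-- **Change of coefficients**: for `φ : R → S`, `κ' = φ_* κ` (both with the hard Lefschetz
property) and traces with `τ' ∘ φ_* = φ ∘ τ`, `φ (Q_{κ,τ}(x, y)) = Q_{κ',τ'}(φ_* x, φ_* y)` — for
`ℚ ⊆ ℂ`: the complexified polarisation form is the same formula on `H•(Y; ℂ)`.
[cite: VoisinHodgeI2002, §7.1.2] [cite: HatcherAT2002, §3.1 p. 198 and §3.2 p. 215] -/
theorem map_polarizationForm_of_eq {S : Type v} [CommRing S] (φ : R →+* S)
    {κ' : singularCohomology S S Y 2} (e : singularCohomology.ringChange φ Y 2 κ = κ')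
    (hL' : HasHardLefschetzProperty κ' n)
    (hvan' : ∀ m, 2 * n < m → Subsingleton (singularCohomology S S Y m))
    (τ : singularCohomology R R Y (2 * n) →ₗ[R] R) (τ' : singularCohomology S S Y (2 * n) →ₗ[S] S)
    (hτ : ∀ z, τ' (singularCohomology.ringChange φ Y (2 * n) z) = φ (τ z))
    {i : ℕ} (x y : singularCohomology R R Y i) :
    φ (polarizationForm κ n hL hvan τ i x y) =
      polarizationForm κ' n hL' hvan' τ' i (singularCohomology.ringChange φ Y i x)
        (singularCohomology.ringChange φ Y i y) := by
  rw [polarizationForm_apply, polarizationForm_apply, map_sum]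
  refine Finset.sum_congr rfl fun p _ ↦ ?_
  rw [← ringChange_primitivePart_of_eq hL hvan φ e hL' hvan',
    ← ringChange_primitivePart_of_eq hL hvan φ e hL' hvan']
  rcases le_or_gt p.1.1 n with ha | ha
  · obtain ⟨s, hs⟩ : ∃ s, p.1.1 + s = n := ⟨n - p.1.1, by omega⟩
    have hm : p.1.1 + 2 * s = 2 * n - p.1.1 := by omega
    have h : (2 * n - p.1.1) + p.1.1 = 2 * n := by omega
    rw [hodgeRiemannPairing_apply τ hs hm h, hodgeRiemannPairing_apply τ' hs hm h, map_mul, map_pow,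
      map_neg, map_one, ← hτ, singularCohomology.ringChange_cupProduct,
      ringChange_lefschetzPowTo_of_eq φ e]
  · rw [hodgeRiemannPairing_of_lt τ ha, hodgeRiemannPairing_of_lt τ' ha, LinearMap.zero_apply,
      LinearMap.zero_apply, LinearMap.zero_apply, LinearMap.zero_apply, map_zero]

/-- The polarisation form on a Lefschetz summand: for `x = Lᵗ x'`, `y` arbitrary, only the index
`p = (a, t)` contributes: `Q(Lᵗ x', y) = B_a(x', ξ_p y)` (`a + t ≤ n`, `x'` primitive).
[cite: VoisinHodgeI2002, §6.3.2 and §7.1.2] -/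
theorem polarizationForm_lefschetzPowTo_left (τ : singularCohomology R R Y (2 * n) →ₗ[R] R) {i : ℕ}
    (p : {p : ℕ × ℕ // p.1 + 2 * p.2 = i}) (hp : p.1.1 + p.1.2 ≤ n)
    {x' : singularCohomology R R Y p.1.1} (hx' : x' ∈ primitiveClasses κ n p.1.1)
    (y : singularCohomology R R Y i) :
    polarizationForm κ n hL hvan τ i (lefschetzPowTo κ p.1.2 p.1.1 i p.2 x') y =
      hodgeRiemannPairing κ n τ p.1.1 x' (primitivePart κ n hL hvan p y) := by
  rw [polarizationForm_apply, Finset.sum_eq_single p]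
  · rw [primitivePart_lefschetzPowTo_of_mem hL hvan p hp hx']
  · intro q _ hqp
    rw [primitivePart_eq_zero_of_mem_ne hL hvan (Ne.symm hqp) (lefschetzPowTo_mem_lefschetzSummand p.2 hx'),
      LinearMap.map_zero, LinearMap.zero_apply]
  · intro h
    exact absurd (Finset.mem_univ p) h

end HodgeTheory

end Literature.AlgebraicGeometry.HodgeTheory
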